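import Literature.MathematicalPhysics.QuantumLattice.EmeryThreeBandRingWindowFloor
import HarnessLib

/-!
# The `CuO₄` PLUS WINDOW of the decorated `CuO₂` lattice: the five-site unit Cu + its four oxygens already carries an even translate of
# every interacting shape of the three-band interaction — a turnkey Emery cluster floor from ONE `4⁵ = 1024`-dimensional certificate

Topic `Literature/MathematicalPhysics/QuantumLattice` (family `hubbard`; crews hubbard-fast S2 (iv) «three-band Emery boxes» and
`pub/hubbard-downfold` (S1 router, the typed Emery six-boxes), seat hubbard-downfold-mod-4). `EmeryThreeBandRingWindowFloor` (hubbard-box-p1)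
discharges the covering hypothesis `hfit` of `le_emeryEnergyDensity_of_posSemidef_uniform` for the 7-site `Cu₃O₄` ring (Fock dimension `4⁷`,
largest spin sector `1225` — above the kernel cluster device's practical sector ceiling `≈ 600`, hubbard-box-p2 2026-08-28). This file does the
same for the SMALLEST window: the classic `CuO₄` unit, written in non-negative coordinates as the plus
`W₅ = {(2,2), (1,2), (3,2), (2,1), (2,3)}` (Cu at `(2,2)`, O_x at `(1,2),(3,2)`, O_y at `(2,1),(2,3)`; Fock dimension `4⁵ = 1024`, largest sector
`C(5,2)·C(5,3) = 100`). Both Cu–O orientations of each axis occur because the Cu has an oxygen on both sides, and the four O_x–O_y classes are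
exactly the four O–O bonds of the one plaquette; no term touches the dummy sublattice.

* §1 `emeryCuO4Window` and its coordinate description;
* §2 **`emeryCuO4Window_fit`**: every interacting shape of `emeryInteraction θ` (box-p1's `exists_shape_of_emeryInteraction_apply_ne_zero`: Cu / O_x /
  O_y sites, `e₁`-bonds from Cu or O_x, `e₂`-bonds from Cu or O_y, O_x–O_y bonds along `ppVec k`) has an EVEN translate inside `W₅`, for every `θ`
  (explicit witnesses: `{(2,2),(3,2)}`, `{(1,2),(2,2)}`, `{(2,2),(2,3)}`, `{(2,1),(2,2)}`, `{(1,2),(2,3)}`, `{(3,2),(2,3)}`, `{(1,2),(2,1)}`, `{(3,2),(2,1)}`,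
  `{(2,2)}`, `{(1,2)}`, `{(2,1)}`);
* §3 **`le_emeryEnergyDensity_of_cuO4Certificate`**: for `M > 0`, any `G ∈ 𝔄_{W₅}` killed by `2×2`-periodic states and a certificate
  `H^{w}_{W₅}[emeryInteraction θ] + G − q₀·1 ⪰ 0` with the uniform `(2ℤ)²`-weight of mass `M`: `q₀/(4M) ≤ emeryEnergyDensity θ ρ` (nonempty class).
  With the Summits-side seam `Downfold/EmeryClusterFloorSeam` (four lower-face corners ⇒ typed box word) this is the cheapest route to a certified
  three-band floor word on a router box.

Definition with body: `emeryCuO4Window`; everything else PROVED; no named fact, no number. HONEST SCOPE: a covering fact and a floor LAW; the floor a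
single `CuO₄` unit gives (oxygen on-site terms at half weight under the uniform weight: placement counts bonds 1, Cu 1, O_x 2, O_y 2 — recount in the
device) is an Anderson-class bound, crude by construction; larger windows / optimised admissible weights tighten it.

## Mathlib / tree search

REUSED: `exists_shape_of_emeryInteraction_apply_ne_zero`, `emeryRingWindow`-style coordinate bookkeeping (`EmeryThreeBandRingWindowFloor`);
`le_emeryEnergyDensity_of_posSemidef_uniform`, `uniformPeriodicWeight` (`WeightedOpenClusterUniformWeightsPeriodic`); `emeryInteraction`
(`EmeryThreeBandClusterFloor`); `InCoset`, `liebPeriods`, `cuSite/oxSite/oySite`, `ppVec`, `unitVec`; `shiftSet_pair_eq`, `shiftSet_singleton_eq`,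
`mem_halfOpenBox`. `lean search 'CuO4Window|cuO4|plusWindow'` (2026-08-28): nothing.

## References

* P. W. Anderson, Phys. Rev. 83 (1951) 1260, eq. (2). [cite: Anderson1951, eq. (2)]
* R. Valentí, J. Stolze, P. J. Hirschfeld, Phys. Rev. B 43 (1991) 13743, §II. [cite: ValentiStolzeHirschfeld1991, §II]
* E. Pavarini et al., Phys. Rev. Lett. 87 (2001) 047003, eq. (1). [cite: PavariniEtAl2001, eq. (1)]
* H. Araki, H. Moriya, Rev. Math. Phys. 15 (2003) 93, §4.1. [cite: ArakiMoriya2003, §4.1 Def. 4.5]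
-/

noncomputable section

open scoped ComplexOrder BigOperators
open Finset

namespace Literature.MathematicalPhysics.QuantumLattice

open Matrix HubbardWave0 Literature.Probability.LatticeModels ThermodynamicLimit
open scoped Matrix.Norms.L2Operator

/-! ### §1 The `CuO₄` plus window -/

/-- **The `CuO₄` plus window** `W₅ = {(2,2), (1,2), (3,2), (2,1), (2,3)} ⊆ [0,4)²` (Cu at `(2,2)`; O_x at `(1,2),(3,2)`; O_y at `(2,1),(2,3)`): the copper
site with its four oxygen neighbours. [cite: ValentiStolzeHirschfeld1991, §II] -/
def emeryCuO4Window : Finset (Site 2) :=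
  (halfOpenBox 2 4).filter fun x => (x 0 = 2 ∨ x 1 = 2) ∧ x 0 ≠ 0 ∧ x 1 ≠ 0

/-- Coordinates of the plus window. [cite: ValentiStolzeHirschfeld1991, §II] -/
theorem mem_emeryCuO4Window_iff {x : Site 2} :
    x ∈ emeryCuO4Window ↔ (∀ i, 0 ≤ x i ∧ x i < 4) ∧ (x 0 = 2 ∨ x 1 = 2) ∧ x 0 ≠ 0 ∧ x 1 ≠ 0 := by
  rw [emeryCuO4Window, Finset.mem_filter, mem_halfOpenBox]
  norm_num

/-- Membership by the two coordinates. [cite: ValentiStolzeHirschfeld1991, §II] -/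
theorem mem_emeryCuO4Window_of_coords {x : Site 2} {a b : ℤ} (h0 : x 0 = a) (h1 : x 1 = b)
    (h : ((0 ≤ a ∧ a < 4) ∧ (0 ≤ b ∧ b < 4)) ∧ (a = 2 ∨ b = 2) ∧ a ≠ 0 ∧ b ≠ 0) : x ∈ emeryCuO4Window := by
  rw [mem_emeryCuO4Window_iff, Fin.forall_fin_two, h0, h1]
  exact h

/-- The plus window has five sites (Fock dimension `4⁵`). [cite: ValentiStolzeHirschfeld1991, §II] -/
theorem card_emeryCuO4Window : emeryCuO4Window.card = 5 := by
  rw [emeryCuO4Window, halfOpenBox]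
  decide

/-! ### §2 Every interacting shape has an even translate inside the plus -/

/-- From `InCoset (2,2) s₀ x` and the parities of `s − s₀`: `s − x ∈ (2ℤ)²`. [cite: ArakiMoriya2003, §4.1] -/
private theorem inCoset_zero_sub_of_inCoset' {s₀ s x : Site 2} (hx : InCoset liebPeriods s₀ x) (h0 : (s 0 - s₀ 0) % 2 = 0)
    (h1 : (s 1 - s₀ 1) % 2 = 0) : InCoset liebPeriods 0 (s - x) := by
  intro i
  have hxi := hx i
  have hq : ((liebPeriods i : ℕ) : ℤ) + 1 = 2 := by fin_cases i <;> simp [liebPeriods]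
  rw [hq] at hxi ⊢
  fin_cases i
  · simp only [Pi.sub_apply, Pi.zero_apply, sub_zero] at hxi ⊢
    simp only [Fin.zero_eta] at hxi ⊢
    omega
  · simp only [Pi.sub_apply, Pi.zero_apply, sub_zero] at hxi ⊢
    simp only [Fin.mk_one] at hxi ⊢
    omega

/-- Translating a pair by `s − x`: `{x, x+u} + (s − x) = {s, s+u}`. [cite: ArakiMoriya2003, §4.1] -/
private theorem shiftSet_pair_sub' (x s u : Site 2) : shiftSet (s - x) ({x, x + u} : Finset (Site 2)) = {s, s + u} := by
  rw [shiftSet_pair_eq, add_sub_cancel, show x + u + (s - x) = s + u by abel]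

/-- Translating a singleton by `s − x`: `{x} + (s − x) = {s}`. [cite: ArakiMoriya2003, §4.1] -/
private theorem shiftSet_singleton_sub' (x s : Site 2) : shiftSet (s - x) ({x} : Finset (Site 2)) = {s} := by
  rw [shiftSet_singleton_eq, add_sub_cancel]

/-- A pair of window sites is inside the window. [cite: ValentiStolzeHirschfeld1991, §II] -/
private theorem pair_subset_plus {s u : Site 2} (hs : s ∈ emeryCuO4Window) (hsu : s + u ∈ emeryCuO4Window) :
    ({s, s + u} : Finset (Site 2)) ⊆ emeryCuO4Window :=
  Finset.insert_subset hs (Finset.singleton_subset_iff.2 hsu)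

/-- The Cu root `(2,2)`. [cite: PavariniEtAl2001, eq. (1)] -/
private def cuRoot : Site 2 := cuSite + 2 • unitVec 0 + 2 • unitVec 1
/-- The left O_x root `(1,2)`. [cite: PavariniEtAl2001, eq. (1)] -/
private def oxRootL : Site 2 := oxSite + 2 • unitVec 1
/-- The right O_x root `(3,2)`. [cite: PavariniEtAl2001, eq. (1)] -/
private def oxRootR : Site 2 := oxSite + 2 • unitVec 0 + 2 • unitVec 1
/-- The lower O_y root `(2,1)`. [cite: PavariniEtAl2001, eq. (1)] -/
private def oyRootD : Site 2 := oySite + 2 • unitVec 0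

/-- **`hfit` FOR THE PLUS**: every interacting shape of the three-band interaction (at any `θ`) has an even translate inside the `CuO₄` plus window —
hence so does every shape rooted at a cell point. Witnesses: `e₁` from Cu ↦ `{(2,2),(3,2)}`, `e₁` from O_x ↦ `{(1,2),(2,2)}`, `e₂` from Cu ↦
`{(2,2),(2,3)}`, `e₂` from O_y ↦ `{(2,1),(2,2)}`, O–O `(1,1)` ↦ `{(1,2),(2,3)}`, `(−1,1)` ↦ `{(3,2),(2,3)}`, `(1,−1)` ↦ `{(1,2),(2,1)}`, `(−1,−1)` ↦
`{(3,2),(2,1)}`, sites ↦ `(2,2)`, `(1,2)`, `(2,1)`. [cite: ValentiStolzeHirschfeld1991, §II] -/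
theorem emeryCuO4Window_fit (θ : Fin 14 → ℝ) :
    ∀ (c : Cell liebPeriods) (X : Finset (Site 2)), cellPos c ∈ X → (emeryInteraction θ).Φ X ≠ 0 →
      ∃ v : Site 2, InCoset liebPeriods 0 v ∧ shiftSet v X ⊆ emeryCuO4Window := by
  intro c X _ hX
  have hcu0 : cuRoot 0 = 2 := by simp [cuRoot, cuSite, unitVec]
  have hcu1 : cuRoot 1 = 2 := by simp [cuRoot, cuSite, unitVec]
  have hoxL0 : oxRootL 0 = 1 := by simp [oxRootL, oxSite, unitVec]
  have hoxL1 : oxRootL 1 = 2 := by simp [oxRootL, oxSite, unitVec]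
  have hoxR0 : oxRootR 0 = 3 := by simp [oxRootR, oxSite, unitVec]
  have hoxR1 : oxRootR 1 = 2 := by simp [oxRootR, oxSite, unitVec]
  have hoyD0 : oyRootD 0 = 2 := by simp [oyRootD, oySite, unitVec]
  have hoyD1 : oyRootD 1 = 1 := by simp [oyRootD, oySite, unitVec]
  have hcu : cuRoot ∈ emeryCuO4Window := mem_emeryCuO4Window_of_coords hcu0 hcu1 (by norm_num)
  have hoxL : oxRootL ∈ emeryCuO4Window := mem_emeryCuO4Window_of_coords hoxL0 hoxL1 (by norm_num)
  have hoxR : oxRootR ∈ emeryCuO4Window := mem_emeryCuO4Window_of_coords hoxR0 hoxR1 (by norm_num)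
  have hoyD : oyRootD ∈ emeryCuO4Window := mem_emeryCuO4Window_of_coords hoyD0 hoyD1 (by norm_num)
  -- parities of the roots relative to their coset labels
  have pcu0 : (cuRoot 0 - (cuSite : Site 2) 0) % 2 = 0 := by simp [cuRoot, cuSite, unitVec]
  have pcu1 : (cuRoot 1 - (cuSite : Site 2) 1) % 2 = 0 := by simp [cuRoot, cuSite, unitVec]
  have poxL0 : (oxRootL 0 - (oxSite : Site 2) 0) % 2 = 0 := by simp [oxRootL, oxSite, unitVec]
  have poxL1 : (oxRootL 1 - (oxSite : Site 2) 1) % 2 = 0 := by simp [oxRootL, oxSite, unitVec]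
  have poxR0 : (oxRootR 0 - (oxSite : Site 2) 0) % 2 = 0 := by simp [oxRootR, oxSite, unitVec]
  have poxR1 : (oxRootR 1 - (oxSite : Site 2) 1) % 2 = 0 := by simp [oxRootR, oxSite, unitVec]
  have poyD0 : (oyRootD 0 - (oySite : Site 2) 0) % 2 = 0 := by simp [oyRootD, oySite, unitVec]
  have poyD1 : (oyRootD 1 - (oySite : Site 2) 1) % 2 = 0 := by simp [oyRootD, oySite, unitVec]
  rcases exists_shape_of_emeryInteraction_apply_ne_zero θ hX with ⟨x, rfl, hc⟩ | ⟨x, rfl, hc⟩ | ⟨x, k, rfl, hc⟩ | ⟨x, rfl, hc⟩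
  · -- `e₁` bonds: from Cu put at `(2,2)` → `(3,2)`; from O_x put at `(1,2)` → `(2,2)`
    rcases hc with hc | hc
    · refine ⟨cuRoot - x, inCoset_zero_sub_of_inCoset' hc pcu0 pcu1, ?_⟩
      rw [shiftSet_pair_sub']
      exact pair_subset_plus hcu (mem_emeryCuO4Window_of_coords (a := 3) (b := 2)
        (by simp [cuRoot, cuSite, unitVec]) (by simp [cuRoot, cuSite, unitVec]) (by norm_num))
    · refine ⟨oxRootL - x, inCoset_zero_sub_of_inCoset' hc poxL0 poxL1, ?_⟩
      rw [shiftSet_pair_sub']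
      exact pair_subset_plus hoxL (mem_emeryCuO4Window_of_coords (a := 2) (b := 2)
        (by simp [oxRootL, oxSite, unitVec]) (by simp [oxRootL, oxSite, unitVec]) (by norm_num))
  · -- `e₂` bonds: from Cu put at `(2,2)` → `(2,3)`; from O_y put at `(2,1)` → `(2,2)`
    rcases hc with hc | hc
    · refine ⟨cuRoot - x, inCoset_zero_sub_of_inCoset' hc pcu0 pcu1, ?_⟩
      rw [shiftSet_pair_sub']
      exact pair_subset_plus hcu (mem_emeryCuO4Window_of_coords (a := 2) (b := 3)
        (by simp [cuRoot, cuSite, unitVec]) (by simp [cuRoot, cuSite, unitVec]) (by norm_num))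
    · refine ⟨oyRootD - x, inCoset_zero_sub_of_inCoset' hc poyD0 poyD1, ?_⟩
      rw [shiftSet_pair_sub']
      exact pair_subset_plus hoyD (mem_emeryCuO4Window_of_coords (a := 2) (b := 2)
        (by simp [oyRootD, oySite, unitVec]) (by simp [oyRootD, oySite, unitVec]) (by norm_num))
  · -- O_x–O_y bonds: `(1,1)` and `(1,−1)` from the left O_x `(1,2)`; `(−1,1)` and `(−1,−1)` from the right O_x `(3,2)`
    fin_cases k
    · refine ⟨oxRootL - x, inCoset_zero_sub_of_inCoset' hc poxL0 poxL1, ?_⟩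
      rw [shiftSet_pair_sub']
      exact pair_subset_plus hoxL (mem_emeryCuO4Window_of_coords (a := 2) (b := 3)
        (by simp [oxRootL, oxSite, unitVec, ppVec]) (by simp [oxRootL, oxSite, unitVec, ppVec]) (by norm_num))
    · refine ⟨oxRootR - x, inCoset_zero_sub_of_inCoset' hc poxR0 poxR1, ?_⟩
      rw [shiftSet_pair_sub']
      exact pair_subset_plus hoxR (mem_emeryCuO4Window_of_coords (a := 2) (b := 3)
        (by simp [oxRootR, oxSite, unitVec, ppVec]) (by simp [oxRootR, oxSite, unitVec, ppVec]) (by norm_num))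
    · refine ⟨oxRootL - x, inCoset_zero_sub_of_inCoset' hc poxL0 poxL1, ?_⟩
      rw [shiftSet_pair_sub']
      exact pair_subset_plus hoxL (mem_emeryCuO4Window_of_coords (a := 2) (b := 1)
        (by simp [oxRootL, oxSite, unitVec, ppVec]) (by simp [oxRootL, oxSite, unitVec, ppVec]) (by norm_num))
    · refine ⟨oxRootR - x, inCoset_zero_sub_of_inCoset' hc poxR0 poxR1, ?_⟩
      rw [shiftSet_pair_sub']
      exact pair_subset_plus hoxR (mem_emeryCuO4Window_of_coords (a := 2) (b := 1)
        (by simp [oxRootR, oxSite, unitVec, ppVec]) (by simp [oxRootR, oxSite, unitVec, ppVec]) (by norm_num))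
  · -- sites
    rcases hc with hc | hc | hc
    · refine ⟨cuRoot - x, inCoset_zero_sub_of_inCoset' hc pcu0 pcu1, ?_⟩
      rw [shiftSet_singleton_sub', Finset.singleton_subset_iff]
      exact hcu
    · refine ⟨oxRootL - x, inCoset_zero_sub_of_inCoset' hc poxL0 poxL1, ?_⟩
      rw [shiftSet_singleton_sub', Finset.singleton_subset_iff]
      exact hoxL
    · refine ⟨oyRootD - x, inCoset_zero_sub_of_inCoset' hc poyD0 poyD1, ?_⟩
      rw [shiftSet_singleton_sub', Finset.singleton_subset_iff]
      exact hoyD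

/-! ### §3 The turnkey plus floor -/

namespace InfVolFermionState

/-- **THE TURNKEY EMERY `CuO₄` FLOOR.** For `M > 0`, any `G ∈ 𝔄_{W₅}` killed by every `2×2`-periodic state, and a cluster certificate
`H^{w}_{W₅}[emeryInteraction θ] + G − q₀·1 ⪰ 0` on the plus window `W₅` with the uniform `(2ℤ)²`-weight `w` of mass `M`:
`q₀/(4M) ≤ emeryEnergyDensity θ ρ` for every `ρ` with `emeryStates ρ` nonempty. [cite: Anderson1951, eq. (2)] [cite: ValentiStolzeHirschfeld1991, §II] -/
theorem le_emeryEnergyDensity_of_cuO4Certificate (θ : Fin 14 → ℝ) {ρ : ℝ} (hS : (emeryStates ρ).Nonempty) {M : ℝ} (hM : 0 < M)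
    {G : FermionOp emeryCuO4Window} (hG0 : ∀ ω' : InfVolFermionState 2, ω'.IsPeriodic liebPeriods → (ω'.expect emeryCuO4Window G).re = 0)
    {q₀ : ℝ}
    (hq : ((⟨fun X => (uniformPeriodicWeight liebPeriods emeryCuO4Window M X : ℂ) • (emeryInteraction θ).Φ X⟩ : FermionInteraction 2).localHamiltonian
      emeryCuO4Window + G - (q₀ : ℂ) • (1 : FermionOp emeryCuO4Window)).PosSemidef) :
    q₀ / (4 * M) ≤ emeryEnergyDensity θ ρ :=
  le_emeryEnergyDensity_of_posSemidef_uniform θ hS emeryCuO4Window hM (emeryCuO4Window_fit θ) hG0 hq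

end InfVolFermionState

end Literature.MathematicalPhysics.QuantumLattice

end
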